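import Literature.Geometry.Kaehler.ComplexTorusPrimitiveHodgeStructureHodgeNumbers
import Literature.Geometry.Kaehler.ComplexTorusLatticeSpInvariantFormsIndefinite
import HarnessLib

/-!
# The Hodge numbers of the Lefschetz pieces `H^{k-2r}(X, ℚ)_prim(-r)` and the Lefschetz decomposition read on
# Hodge numbers: `h^{p,q}(Hᵏ(X, ℚ)) = Σ_r h^{p-r,q-r}_pr`

Layer `Literature/Geometry/Kaehler`, namespace `Literature.Geometry.Kaehler.ComplexTorus`; lane `lit-hodgefound`
(Track 2 foundations library), seat p09, generation 28, row g28-#8. THEOREMS ONLY (no definition, no named fact,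
net debt 0).

Sequel of g28-#7 `ComplexTorusPrimitiveHodgeStructureHodgeNumbers` (`h^{p,q}(Hᵏ(X, ℚ)_prim) = h^{p,q}_pr(g) =
C(g,p)C(g,q) - C(g,p-1)C(g,q-1)`, and one step of the Lefschetz decomposition on Hodge numbers,
`h^{p+1,q+1}(Hᵏ) = h^{p+1,q+1}(Hᵏ_prim) + h^{p,q}(Hᵏ⁻²)`). The tree's `IsNSForm.lefschetzPiece Φ k r` is the `r`-th
piece `H^{k-2r}(X, ℚ)_prim(-r)` of the Lefschetz decomposition isomorphism of `ℚ`-Hodge structures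
`⊕_{2r ≤ k} H^{k-2r}(X, ℚ)_prim(-r) ≅ Hᵏ(X, ℚ)` (`IsNSForm.lefschetzDecompositionHom`, bijective for `k ≤ g`). THIS FILE:

* §1 **`h^{p,q}(H^{k-2r}_prim(-r)) = h^{p-r,q-r}(H^{k-2r}_prim)`** (Tate twist shifts the bigrading by `(r, r)`), hence
  `= h^{p-r,q-r}_pr(g)` for `r ≤ p, q` and `0` for `r > min(p, q)` (the primitive structure is effective);
* §2 **THE LEFSCHETZ DECOMPOSITION ON HODGE NUMBERS: `h^{p,q}(Hᵏ(X, ℚ)) = C(g,p) C(g,q) = Σ_{r ≤ min(p,q)} h^{p-r,q-r}_pr(g)`**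
  (`p + q = k ≤ g`; induction on `min(p, q)` with g28-#7's one-step identity) and, on the model-layer objects,
  **`Σ_{2r ≤ k} h^{p,q}(H^{k-2r}(X, ℚ)_prim(-r)) = h^{p,q}(Hᵏ(X, ℚ))`**.

## The sources, verbatim

* H. Lange, *Abelian Varieties over the Complex Numbers* (2023), §5.4.2 Thm. 5.4.6 with (5.28)
  `H^{p,q}(M) = H^{p,q}_pr ⊕ L H^{p-1,q-1}(M)` and (5.29); §7.3.2 (3) `⋀ᵏ V = Pᵏ ⊕ L P^{k-2} ⊕ L² P^{k-4} ⊕ ⋯`;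
  §5.4.6 Exercise (3) `h^{p,q} = C(g,p) C(g,q)`.
* P. Deligne, *Théorie de Hodge II* (1971), 2.1.13–2.1.14 (Tate twist: `H(j)^{p,q} = H^{p+j,q+j}`), 2.3.5 (iii).
* C. Voisin, *Hodge Theory and Complex Algebraic Geometry I* (2002), §6.2.3 Cor. 6.26, Rem. 6.27; §7.1.2 (PDF p. 134).

## References

* [cite: Lange2023AbelianVarietiesComplex, §5.4.2 Thm. 5.4.6 (5.28)–(5.29); §7.3.2 (3); §5.4.6 Exercise (3)]
* [cite: DeligneHodgeII1971, 2.1.13–2.1.14; 2.3.5 (iii)]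
* [cite: VoisinHodgeI2002, §6.2.3 Cor. 6.26, Rem. 6.27; §7.1.2 (PDF p. 134)]
-/

noncomputable section

open Module Complex
open scoped TensorProduct
open Literature.AlgebraicGeometry.Motives Literature.AlgebraicGeometry.Motives.HodgeStructure

namespace Literature.Geometry.Kaehler.ComplexTorus

variable {ι : Type*} [Fintype ι] {E : Type*} [NormedAddCommGroup E] [NormedSpace ℂ E]
  [FiniteDimensional ℂ E] (Φ : (ι → ℝ) ≃L[ℝ] E) {η : E [⋀^Fin 2]→L[ℝ] ℝ}

/-! ## §1 The Hodge numbers of the pieces `H^{k-2r}(X, ℚ)_prim(-r)` -/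

omit [FiniteDimensional ℂ E] in
/-- **`h^{p,q}(H^{k-2r}(X, ℚ)_prim(-r)) = h^{p-r,q-r}(H^{k-2r}(X, ℚ)_prim)`**: the Tate twist `(-r)` shifts the Hodge
pieces by `(r, r)` (`H(j)^{p,q} = H^{p+j,q+j}`), the weight transport does not change them.
[cite: DeligneHodgeII1971, 2.1.13–2.1.14] [cite: Lange2023AbelianVarietiesComplex, §5.4.1 (5.23)] -/
theorem IsNSForm.hodgeNumber_lefschetzPiece (hη : IsNSForm Φ η) (k : ℕ) (r : Fin (k / 2 + 1)) (p q : ℤ) :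
    (hη.lefschetzPiece Φ k r).hodgeNumber p q =
      (hη.primitiveHodgeStructure Φ (k - 2 * r)).hodgeNumber (p - r) (q - r) := by
  rw [IsNSForm.lefschetzPiece, HodgeStructure.hodgeNumber, HodgeStructure.hodgeNumber, cast_piece, piece_tateTwist,
    ← sub_eq_add_neg, ← sub_eq_add_neg]

/-- **`h^{p,q}(H^{k-2r}(X, ℚ)_prim(-r)) = h^{p-r,q-r}_pr(g) = C(g,p-r)C(g,q-r) - C(g,p-r-1)C(g,q-r-1)`** for
`r ≤ p`, `r ≤ q`, `p + q = k ≤ g = dim_ℂ E` (`η ∈ NS(X)` a non-degenerate real `(1,1)`-form).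
[cite: Lange2023AbelianVarietiesComplex, §5.4.2 Thm. 5.4.6 (5.28)–(5.29)] [cite: DeligneHodgeII1971, 2.1.13] -/
theorem IsNSForm.hodgeNumber_lefschetzPiece_eq (hη : IsNSForm Φ η) (hnd : ∀ v : E, v ≠ 0 → ∃ w : E, η ![v, w] ≠ 0)
    (h11 : ∀ u v : E, η ![I • u, I • v] = η ![u, v]) {k : ℕ} (hk : k ≤ finrank ℂ E) (r : Fin (k / 2 + 1)) {p q : ℕ}
    (hpq : p + q = k) (hrp : (r : ℕ) ≤ p) (hrq : (r : ℕ) ≤ q) :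
    (hη.lefschetzPiece Φ k r).hodgeNumber p q = primitiveHodgeNumber (finrank ℂ E) (p - r) (q - r) := by
  have e1 : ((p - r : ℕ) : ℤ) = (p : ℤ) - ((r : ℕ) : ℤ) := Nat.cast_sub hrp
  have e2 : ((q - r : ℕ) : ℤ) = (q : ℤ) - ((r : ℕ) : ℤ) := Nat.cast_sub hrq
  have h := hη.hodgeNumber_primitiveHodgeStructure Φ hnd h11 (k := k - 2 * r) (by omega) (p := p - r) (q := q - r)
    (by omega)
  rw [e1, e2] at h
  rw [hη.hodgeNumber_lefschetzPiece Φ k r, h]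

omit [FiniteDimensional ℂ E] in
/-- **`h^{p,q}(H^{k-2r}(X, ℚ)_prim(-r)) = 0` for `p < r` or `q < r`** (the primitive Hodge structure is effective:
no pieces of negative index). [cite: DeligneHodgeII1971, 2.1.13–2.1.14] [cite: Lange2023AbelianVarietiesComplex, §5.4.2 (5.28)] -/
theorem IsNSForm.hodgeNumber_lefschetzPiece_eq_zero_of_lt (hη : IsNSForm Φ η) (k : ℕ) (r : Fin (k / 2 + 1))
    {p q : ℕ} (h : p < r ∨ q < r) : (hη.lefschetzPiece Φ k r).hodgeNumber p q = 0 := by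
  rw [hη.hodgeNumber_lefschetzPiece Φ k r, HodgeStructure.hodgeNumber, IsNSForm.primitiveHodgeStructure]
  rcases h with h | h
  · rw [HodgeStructure.ofPieces_piece_eq_bot_of_neg_left _ _ _ _ (by omega), finrank_bot]
  · rw [HodgeStructure.ofPieces_piece_eq_bot_of_neg_right _ _ _ _ (by omega), finrank_bot]

/-! ## §2 The Lefschetz decomposition on Hodge numbers -/

/-- **`h^{p,q}(Hᵏ(X, ℚ)) = C(g,p) C(g,q) = Σ_{r ≤ min(p,q)} h^{p-r,q-r}_pr(g)`** (`p + q = k ≤ g = dim_ℂ E`; any torus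
`X = E/Φ(ℤ^ι)` carrying a non-degenerate `(1,1)`-class `η ∈ NS(X)`): the Lefschetz decomposition
`H^{p,q} = H^{p,q}_pr ⊕ L H^{p-1,q-1}_pr ⊕ L² H^{p-2,q-2}_pr ⊕ ⋯` read on dimensions, by induction on `min(p, q)` with
(5.28) (g28-#7 `hodgeNumber_hodgeStructure_eq_add`). [cite: Lange2023AbelianVarietiesComplex, §5.4.2 Thm. 5.4.6 (5.28)–(5.29); §7.3.2 (3)]
[cite: VoisinHodgeI2002, §6.2.3 Cor. 6.26, Rem. 6.27] -/
theorem IsNSForm.hodgeNumber_hodgeStructure_eq_sum_primitiveHodgeNumber (hη : IsNSForm Φ η)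
    (hnd : ∀ v : E, v ≠ 0 → ∃ w : E, η ![v, w] ≠ 0) (h11 : ∀ u v : E, η ![I • u, I • v] = η ![u, v]) {k : ℕ}
    (hk : k ≤ finrank ℂ E) {p q : ℕ} (hpq : p + q = k) :
    (hodgeStructure Φ k).hodgeNumber p q =
      ∑ r ∈ Finset.range (min p q + 1), primitiveHodgeNumber (finrank ℂ E) (p - r) (q - r) := by
  obtain ⟨m, hm⟩ : ∃ m, min p q = m := ⟨_, rfl⟩
  rw [hm]
  induction m generalizing p q k with
  | zero =>
    rw [zero_add, Finset.sum_range_one, Nat.sub_zero, Nat.sub_zero]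
    have h := hodgeNumber_hodgeStructure Φ k hpq
    rcases Nat.eq_zero_or_pos p with rfl | hp
    · rw [Nat.choose_zero_right, one_mul] at h
      rw [primitiveHodgeNumber_zero_left_eq]
      exact_mod_cast h
    · have hq : q = 0 := by omega
      subst hq
      rw [Nat.choose_zero_right, mul_one] at h
      rw [primitiveHodgeNumber_zero_right_eq]
      exact_mod_cast h
  | succ m ih =>
    obtain ⟨p', rfl⟩ : ∃ p', p = 1 + p' := ⟨p - 1, by omega⟩
    obtain ⟨q', rfl⟩ : ∃ q', q = 1 + q' := ⟨q - 1, by omega⟩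
    have hstep := hη.hodgeNumber_hodgeStructure_eq_add Φ hnd h11 (m := p' + q') (k := k) (p := p') (q := q')
      (by omega) hk rfl
    have hpr := hη.hodgeNumber_primitiveHodgeStructure Φ hnd h11 hk (p := 1 + p') (q := 1 + q') (by omega)
    have hih := ih (k := p' + q') (by omega) rfl (by omega)
    push_cast at hstep hpr hih ⊢
    rw [hstep, hpr, hih, Finset.sum_range_succ' (fun r ↦ primitiveHodgeNumber (finrank ℂ E) (1 + p' - r) (1 + q' - r)),
      Nat.sub_zero, Nat.sub_zero, add_comm]
    refine congrArg (fun n ↦ n + primitiveHodgeNumber (finrank ℂ E) (1 + p') (1 + q'))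
      (Finset.sum_congr rfl fun r _ ↦ ?_)
    rw [show 1 + p' - (r + 1) = p' - r by omega, show 1 + q' - (r + 1) = q' - r by omega]

/-- **`C(g,p) C(g,q) = Σ_{r ≤ min(p,q)} (C(g,p-r) C(g,q-r) - C(g,p-r-1) C(g,q-r-1))`** for `p + q ≤ g` — the numerical
shadow of the Lefschetz decomposition (read off any `g`-dimensional torus with a non-degenerate `(1,1)`-class).
[cite: Lange2023AbelianVarietiesComplex, §5.4.2 (5.28)–(5.29); §5.4.6 Exercise (3)] -/
theorem IsNSForm.choose_mul_choose_eq_sum_primitiveHodgeNumber (hη : IsNSForm Φ η)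
    (hnd : ∀ v : E, v ≠ 0 → ∃ w : E, η ![v, w] ≠ 0) (h11 : ∀ u v : E, η ![I • u, I • v] = η ![u, v]) {p q : ℕ}
    (hpq : p + q ≤ finrank ℂ E) :
    (finrank ℂ E).choose p * (finrank ℂ E).choose q =
      ∑ r ∈ Finset.range (min p q + 1), primitiveHodgeNumber (finrank ℂ E) (p - r) (q - r) := by
  have h := hη.hodgeNumber_hodgeStructure_eq_sum_primitiveHodgeNumber Φ hnd h11 hpq rfl
  rw [hodgeNumber_hodgeStructure Φ (p + q) rfl] at h
  exact h

/-- **THE LEFSCHETZ DECOMPOSITION ON HODGE NUMBERS: `Σ_{2r ≤ k} h^{p,q}(H^{k-2r}(X, ℚ)_prim(-r)) = h^{p,q}(Hᵏ(X, ℚ))`**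
(`p + q = k ≤ g`): the Hodge numbers of the pieces of `⊕_{2r ≤ k} H^{k-2r}(X, ℚ)_prim(-r) ≅ Hᵏ(X, ℚ)`
(`IsNSForm.lefschetzDecompositionHom`, an isomorphism of `ℚ`-Hodge structures) add up to those of `Hᵏ(X, ℚ)` — the
pieces with `r > min(p, q)` contribute `0`. [cite: Lange2023AbelianVarietiesComplex, §5.4.2 Thm. 5.4.6 (5.28); §7.3.2 (3)]
[cite: DeligneHodgeII1971, 2.3.5 (iii)] [cite: VoisinHodgeI2002, §6.2.3 Cor. 6.26] -/
theorem IsNSForm.sum_hodgeNumber_lefschetzPiece (hη : IsNSForm Φ η) (hnd : ∀ v : E, v ≠ 0 → ∃ w : E, η ![v, w] ≠ 0)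
    (h11 : ∀ u v : E, η ![I • u, I • v] = η ![u, v]) {k : ℕ} (hk : k ≤ finrank ℂ E) {p q : ℕ} (hpq : p + q = k) :
    ∑ r : Fin (k / 2 + 1), (hη.lefschetzPiece Φ k r).hodgeNumber p q = (hodgeStructure Φ k).hodgeNumber p q := by
  rw [hη.hodgeNumber_hodgeStructure_eq_sum_primitiveHodgeNumber Φ hnd h11 hk hpq]
  obtain ⟨m, hm⟩ : ∃ m, min p q = m := ⟨_, rfl⟩
  have hm1 : m ≤ p := hm ▸ min_le_left p q
  have hm2 : m ≤ q := hm ▸ min_le_right p q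
  rw [hm]
  -- termwise: the piece Hodge number is `[r ≤ min(p,q)] · h^{p-r,q-r}_pr`
  have hterm : ∀ r : Fin (k / 2 + 1), (hη.lefschetzPiece Φ k r).hodgeNumber p q =
      (fun n : ℕ ↦ if n ≤ m then primitiveHodgeNumber (finrank ℂ E) (p - n) (q - n) else 0) r := by
    intro r
    by_cases h : (r : ℕ) ≤ m
    · simp only [if_pos h]
      exact hη.hodgeNumber_lefschetzPiece_eq Φ hnd h11 hk r hpq (by omega) (by omega)
    · simp only [if_neg h]
      exact hη.hodgeNumber_lefschetzPiece_eq_zero_of_lt Φ k r (by omega)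
  rw [Finset.sum_congr rfl fun r _ ↦ hterm r,
    ← Finset.sum_range (fun n : ℕ ↦ if n ≤ m then primitiveHodgeNumber (finrank ℂ E) (p - n) (q - n) else 0)]
  -- `Σ_{r < k/2+1} [r ≤ m] f r = Σ_{r < m+1} f r`
  have hsub : Finset.range (m + 1) ⊆ Finset.range (k / 2 + 1) := fun x hx ↦ by
    have := Finset.mem_range.1 hx
    exact Finset.mem_range.2 (by omega)
  rw [← Finset.sum_subset hsub fun r _ hr ↦ by
    rw [if_neg (fun h ↦ hr (Finset.mem_range.2 (by omega)))]]
  exact Finset.sum_congr rfl fun r hr ↦ by rw [if_pos (by have := Finset.mem_range.1 hr; omega)]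

end Literature.Geometry.Kaehler.ComplexTorus
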